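import Summits.BirchSwinnertonDyer.BirchSwinnertonDyer.Theorems.TwistFamilyManinDescentRaynaudRegimeClassNoLocalPTorsion
import Summits.BirchSwinnertonDyer.BirchSwinnertonDyer.Theorems.TwistFamilyManinDescentStrongIsUnstarredOfKummerFree
import Summits.BirchSwinnertonDyer.BirchSwinnertonDyer.Theorems.TwistFamilyManinDescentRaynaudRegimeOfOrientation
import HarnessLib

/-!
# Route `TwistFamilyManinDescent`, LINE 16 (bsd-idea-3 g6): the CONE after S16a and G16 landed —
# K15a ⟸ modularity ∧ S16b, and Ray57 ⟸ S16b ∧ K15b (the registered composition `Ray57 h₁…h₄ =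
# G15 (G16 h₄ S16a S16b) K15b h₁…h₄` with S16a, G15, G16 DISCHARGED) — `--supports`, helper

Cell `pub/bsd-wall`, D-0145 line `route-BirchSwinnertonDyer-TeichmullerTwistDescent`, seat `bsd-line-ttd-p1` g7,
working the planner-of-record's TFMD LINE 16. BSD is NOT proved by this; Manin's conjecture is not proved by this;
NOTHING is closed by this file: the engine S16b (`SupersingularKummerFreeStrongIsUnstarred`, stmt-27296) and the
print-extension K15b (`SupersingularUnstarredStrongManinUnit`, stmt-27071) are OPEN, hence so are K15a (stmt-27072)
and Ray57 (`EisensteinRaynaudRegimeManinUnit`, stmt-26325). The file only records, as kernel-checked theorems over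
the route decls, what the Raynaud-regime node now costs: EXACTLY S16b and K15b.

* `supersingularStrongIsUnstarred_of_modularity_of_kummerFreeEngine` — K15a ⟸ `exists_isNewformOf` ∧ S16b
  (G16 `strongIsUnstarredOfKummerFree_proof` fed with the PROVED S16a `raynaudRegimeClassNoLocalPTorsion_proof`);
* `eisensteinRaynaudRegimeManinUnit_of_kummerFreeEngine_of_unstarredStrongManinUnit` — Ray57 ⟸ S16b ∧ K15b
  (G15 `raynaudRegimeOfOrientation_proof` over the previous theorem; modularity is Ray57's OWN fourth antecedent,
  so no free fact enters).

References: [EdixhovenManin1991] B. Edixhoven, in *Arithmetic Algebraic Geometry* (Texel 1989), Progr. Math. 89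
(1991), Thm. 3, Prop. 7; [Mazur1977] Ch. III §5 Step 1 (p. 158); [DiamondShurman2005] Thm. 8.8.1. Design: theorems
only; no definition, no named fact, no `sorry`; axioms `propext`, `Classical.choice`, `Quot.sound`.
-/

set_option autoImplicit false
-- the Theorems directory repeats the summit name (sibling precedent `TwistFamilyManinDescentRaynaudRegimeOfOrientation.lean`)
set_option linter.dupNamespace false

noncomputable section

namespace Summit.BirchSwinnertonDyer.BirchSwinnertonDyer.Theorems.TwistFamilyManinDescent

open Summit.BirchSwinnertonDyer.BirchSwinnertonDyer.Theses.TwistFamilyManinDescent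

/-- **K15a ⟸ modularity ∧ S16b.** `SupersingularStrongIsUnstarred` (stmt-27072: a lattice-optimal curve on the
Raynaud rows with `E[p]` reducible and `p² ∣ N` is UNSTARRED) follows from `exists_isNewformOf` and the engine
`SupersingularKummerFreeStrongIsUnstarred` (stmt-27296) alone — the glue G16 with its S16a antecedent DISCHARGED by
`raynaudRegimeClassNoLocalPTorsion_proof`. CONDITIONAL on S16b (displayed hypothesis); nothing is closed.
[cite: Mazur1977, Ch. III §5, Step 1, p. 158] [cite: DiamondShurman2005, Thm. 8.8.1] -/
theorem supersingularStrongIsUnstarred_of_modularity_of_kummerFreeEngine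
    (hmod : Literature.NumberTheory.EllipticCurves.ModularForms.exists_isNewformOf)
    (h16b : SupersingularKummerFreeStrongIsUnstarred) : SupersingularStrongIsUnstarred :=
  strongIsUnstarredOfKummerFree_proof hmod raynaudRegimeClassNoLocalPTorsion_proof h16b

/-- **Ray57 ⟸ S16b ∧ K15b** — the LINE-15/16 cone with every glue and the local lever discharged:
`EisensteinRaynaudRegimeManinUnit` (stmt-26325) follows from the engine `SupersingularKummerFreeStrongIsUnstarred`
(stmt-27296) and the print-extension `SupersingularUnstarredStrongManinUnit` (stmt-27071); modularity is Ray57's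
own fourth antecedent `h₄`, consumed by K15a's derivation, so no free fact enters:
`Ray57 h₁ h₂ h₃ h₄ = G15 (G16 h₄ S16a S16b) K15b h₁ h₂ h₃ h₄`. CONDITIONAL on S16b and K15b (displayed hypotheses);
nothing is closed. [cite: EdixhovenManin1991, Thm. 3 and Prop. 7] [cite: Mazur1977, Ch. III §5, Step 1, p. 158] -/
theorem eisensteinRaynaudRegimeManinUnit_of_kummerFreeEngine_of_unstarredStrongManinUnit
    (h16b : SupersingularKummerFreeStrongIsUnstarred) (hK15b : SupersingularUnstarredStrongManinUnit) :
    EisensteinRaynaudRegimeManinUnit :=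
  fun h₁ h₂ h₃ h₄ ↦ raynaudRegimeOfOrientation_proof
    (supersingularStrongIsUnstarred_of_modularity_of_kummerFreeEngine h₄ h16b) hK15b h₁ h₂ h₃ h₄

end Summit.BirchSwinnertonDyer.BirchSwinnertonDyer.Theorems.TwistFamilyManinDescent

end
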